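import Mathlib

/-!
# Zeros of the approximants near a zero of the limit (stub `stub_eventually_exists_root_near`)

Crux `RefutationDegree.RefutationBarrier` (stmt-ValiantsHypothesis-5642), line `Sketch_ideator4`,
step (L1a), one complex variable.  Entire functions `p k` converging *continuously* (along every
subsequence, for every convergent sequence of arguments) to a non-zero polynomial `q` with
`q 0 = 0` eventually have a zero in every disc around `0`.

Proof (minimum modulus): pick a radius `ρ < ε` on whose circle `q` has no root, let `δ > 0` be the
minimum of `‖q‖` there; continuous convergence plus compactness of the circle give eventually
`δ / 2 < ‖p k‖` on the circle, while `p k 0 → q 0 = 0`; if `p k` had no zero in the disc, the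
maximum modulus principle for `(p k)⁻¹` would force `δ / 2 ≤ ‖p k 0‖`.
-/

set_option linter.dupNamespace false

noncomputable section

namespace Summit.ValiantsHypothesis.ValiantsHypothesis.Theorems.RefutationDegree

open Filter Topology

/-- A non-zero complex polynomial has only finitely many roots, so some circle of radius
`ρ ∈ (0, ε)` around `0` avoids all of them. -/
private lemma exists_radius_eval_ne_zero (q : Polynomial ℂ) (hq : q ≠ 0) {ε : ℝ} (hε : 0 < ε) :
    ∃ ρ : ℝ, 0 < ρ ∧ ρ < ε ∧ ∀ t : ℂ, ‖t‖ = ρ → q.eval t ≠ 0 := by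
  obtain ⟨ρ, hρ, hρS⟩ :=
    (Set.Ioo_infinite hε).exists_notMem_finset (q.roots.toFinset.image fun z => ‖z‖)
  refine ⟨ρ, hρ.1, hρ.2, fun t ht hqt => hρS ?_⟩
  rw [Finset.mem_image]
  exact ⟨t, Multiset.mem_toFinset.mpr ((Polynomial.mem_roots hq).mpr hqt), ht⟩

/-- **Stub (L1a) — zeros of the approximants near a zero of the limit.**  Entire functions `p k`
converging continuously (along every subsequence) to a non-zero polynomial `q` with `q(0) = 0`
eventually have a zero in every disc around `0` (minimum-modulus principle on a small circle on which
`q` does not vanish). -/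
theorem stub_eventually_exists_root_near
    (p : ℕ → ℂ → ℂ) (q : Polynomial ℂ) (hp : ∀ k, Differentiable ℂ (p k))
    (hcc : ∀ φ : ℕ → ℕ, StrictMono φ → ∀ (t : ℕ → ℂ) (t₀ : ℂ), Tendsto t atTop (𝓝 t₀) →
      Tendsto (fun i => p (φ i) (t i)) atTop (𝓝 (q.eval t₀)))
    (hq : q ≠ 0) (hq0 : q.eval 0 = 0) {ε : ℝ} (hε : 0 < ε) :
    ∀ᶠ k in atTop, ∃ t : ℂ, ‖t‖ < ε ∧ p k t = 0 := by
  -- (1) a circle of radius `ρ < ε` around `0` free of roots of `q`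
  obtain ⟨ρ, hρ, hρε, hroot⟩ := exists_radius_eval_ne_zero q hq hε
  -- (2) the minimum `δ > 0` of `‖q‖` on that circle
  have hS : IsCompact (Metric.sphere (0 : ℂ) ρ) := isCompact_sphere 0 ρ
  have hSne : (Metric.sphere (0 : ℂ) ρ).Nonempty := NormedSpace.sphere_nonempty.mpr hρ.le
  obtain ⟨t₁, ht₁, hmin⟩ :=
    hS.exists_isMinOn hSne (f := fun t => ‖q.eval t‖) q.continuous.norm.continuousOn
  set δ : ℝ := ‖q.eval t₁‖ with hδ_def
  have hδ : 0 < δ := norm_pos_iff.mpr (hroot t₁ (mem_sphere_zero_iff_norm.mp ht₁))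
  have hδle : ∀ t ∈ Metric.sphere (0 : ℂ) ρ, δ ≤ ‖q.eval t‖ := fun t ht =>
    isMinOn_iff.mp hmin t ht
  -- (3) eventually `δ / 2 < ‖p k t‖` on the whole circle (continuous convergence + compactness)
  have h3 : ∀ᶠ k in atTop, ∀ t ∈ Metric.sphere (0 : ℂ) ρ, δ / 2 < ‖p k t‖ := by
    by_contra hcon
    rw [Filter.not_eventually] at hcon
    obtain ⟨φ, hφ, hφP⟩ := Filter.extraction_of_frequently_atTop hcon
    push Not at hφP
    choose t ht hle using hφP
    obtain ⟨t₀, ht₀, ψ, hψ, hlim⟩ := hS.tendsto_subseq ht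
    have hT := (hcc (φ ∘ ψ) (hφ.comp hψ) (t ∘ ψ) t₀ hlim).norm
    have hle' : ‖q.eval t₀‖ ≤ δ / 2 := le_of_tendsto' hT fun i => hle (ψ i)
    have hge := hδle t₀ ht₀
    linarith
  -- (4) eventually `‖p k 0‖ < δ / 2`, since `p k 0 → q 0 = 0`
  have h4 : ∀ᶠ k in atTop, ‖p k 0‖ < δ / 2 := by
    have h0 := (hcc id strictMono_id (fun _ => 0) 0 tendsto_const_nhds).norm
    rw [hq0, norm_zero] at h0
    exact h0.eventually (eventually_lt_nhds (half_pos hδ))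
  -- (5) minimum modulus: a zero-free `p k` on the closed disc contradicts (3) and (4)
  filter_upwards [h3, h4] with k hk3 hk4
  by_contra hno
  push Not at hno
  have hne : ∀ t : ℂ, ‖t‖ ≤ ρ → p k t ≠ 0 := fun t ht => hno t (lt_of_le_of_lt ht hρε)
  have hd : DiffContOnCl ℂ (fun t => (p k t)⁻¹) (Metric.ball (0 : ℂ) ρ) := by
    refine DifferentiableOn.diffContOnCl ?_
    rw [closure_ball (0 : ℂ) hρ.ne']
    intro t ht
    exact (((hp k) t).fun_inv (hne t (mem_closedBall_zero_iff.mp ht))).differentiableWithinAt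
  have hC : ∀ z ∈ frontier (Metric.ball (0 : ℂ) ρ), ‖(p k z)⁻¹‖ ≤ (δ / 2)⁻¹ := by
    intro z hz
    rw [frontier_ball (0 : ℂ) hρ.ne'] at hz
    rw [norm_inv]
    exact inv_anti₀ (half_pos hδ) (hk3 z hz).le
  have h0cl : (0 : ℂ) ∈ closure (Metric.ball (0 : ℂ) ρ) :=
    subset_closure (Metric.mem_ball_self hρ)
  have hmax := Complex.norm_le_of_forall_mem_frontier_norm_le Metric.isBounded_ball hd hC h0cl
  have hp0 : p k 0 ≠ 0 := hne 0 (by simp [hρ.le])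
  have hlt : (δ / 2)⁻¹ < ‖p k 0‖⁻¹ := inv_strictAnti₀ (norm_pos_iff.mpr hp0) hk4
  rw [norm_inv] at hmax
  linarith

end Summit.ValiantsHypothesis.ValiantsHypothesis.Theorems.RefutationDegree

end
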